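import Summits.HodgeConjecture.HodgeConjecture.Theorems.F0P3SLayerFoldShapes   -- ★ p811365 (this seat, K4 ed. 1): token producers + `betaOpp_pointwise_of_SLayer` ∕ `e1coh_pointwise_of_SLayer`
import HarnessLib

/-!
# Crux `H413` — RUNG 3 under CONTRACT v6, K4 part 2 (F0P3-plan (g3) RULING (Q), 2026-08-31T05:13Z): the β_opp fold with the
# archimedean sign clause in RELATIVE, convention-free form, and its TRANSFER variant

Floor-0 programme P3 «U3-mult», seat F0P3-p03 (g5); crux item stmt-HodgeConjecture-24833 (`HCCMUnconditional.H413`); rung-1 line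
`Cruxes/H413/Lines/F0_U3LettersRung1.lean` ed. 2.7 (open stubs `stub_E1 : StubE1coh`, `stub_betaOpp : StubBetaOpp`).  Sibling of ★
`Theorems/F0P3SLayerFoldShapes.lean` (K4 ed. 1, p811365) — a second file only because of the 400-line rule.  PROOF lane: no `def`, no
`sorry`, no named fact asserted; `--supports stmt-HodgeConjecture-24833`.  HONEST LABEL: HC_CM is proved only modulo the printed citations
until rung 0 closes; this file discharges none of them.

WHY RELATIVE (HOME note `F0/P3/p03/ArchSignRecipe.F0P3p03g5.lean`, REF1 (g3) 05:11:57Z, ruling (Q)).  The absolute sign clause of K4 §2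
(`hSgn : … → δ = sgn ξ`) presupposes a packet-level sign `sgn` whose identification with the tree's type `δ` («Rogawski's `J⁺_φ` ↔
`δ = +1`») is a convention bit that [Rogawski1990] does not print (Prop. 15.2.1 (b): `H¹ = ℂ` for BOTH `J^±_φ`) and that the tree does not
pin.  The RELATIVE clause R♭ — «two members `P, P′` of one packet `Π′(ξ)` whose archimedean modules at `ι` detect irreducible `M`, `M′`
with degree-one classes of types `δ, δ′ ∈ {±1}` have `δ = δ′`» (both components are the non-tempered member `πⁿ(ξ_ι)` [§12.3 p. 178,
Prop. 12.3.3 normal form; Prop. 15.2.1 (b)], the square-integrable member having no `H¹` [BorelWallach2000 II §5], and an irreducible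
module carries classes of at most one type, ★ T6a) — is convention-free, weaker, and suffices.  Under ruling (Q) D6 `MemAPacket` is the
FINITE clause only and the step-(5) facts are S2♭, S3♭ (or the in-house transfer T♭), R♭, M♭.

CONTENTS (datum `L ι H T hT μ` = section variables; packet vocabulary BOUND: `{Ξ : Type*} (Mem : DiscreteAutomorphicRep 𝒢 μ → Ξ → Prop)`):
* `betaOpp_pointwise_of_SLayer_rel (Mem) (hS2) (hS3) (hSgnRel) : <StubBetaOpp body after the datum binders, VERBATIM>` — `ξ` for `P`
  (type `+1`), `ξ′` for `P′` (type `−1`) by (hS2); `ξ = ξ′` by (hS3); `1 = −1` by (hSgnRel).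
* `betaOpp_pointwise_of_SLayer_trans (Mem) (hS2) (hTrans) (hSgnRel) : <same>` — `ξ` for `P` by (hS2); `Mem P′ ξ` by the transfer shape
  (hTrans) over the common finite component; `1 = −1` by (hSgnRel).
Shapes: `hS2` = K4 §2's verbatim; `hSgnRel` = β's (`Rogawski1990.cohArchComponentRigid`) binder block from `(M : Type)` on, verbatim, prefixed by
`∀ P P′ (ξ : Ξ), Mem P ξ → Mem P′ ξ →` and concluding `δ = δ′`; `hS3` = K4 §2's verbatim; `hTrans` = `hS3`'s frame with one `ξ` and
conclusion `Mem P ξ → Mem P′ ξ`.  Edition 3 of the line instantiates `Ξ := OneDimAutRepH L`, `Mem := MemAPacket …` by `intro <datum>; exact …`.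

References: [Rogawski1990] J. Rogawski, Ann. of Math. Stud. 123 (1990), Thm. 13.3.5, Thm. 13.3.6 (c), §14.6 Thm. 14.6.4, §12.3 p. 178
(Prop. 12.3.3), Prop. 15.2.1 (b), §15.3 ¶1; [BorelWallach2000] II §5, VI Thm. 4.11.
-/

-- Mathlib idiom (as in ★ `GKModules`, ★ `F0P3SLayerFoldShapes`): commutator bracket on `Module.End ℂ V`
attribute [local instance 100] LieRing.ofAssociativeRing

set_option autoImplicit false
set_option linter.dupNamespace false

noncomputable section

namespace Summit.HodgeConjecture.HodgeConjecture.Cruxes.H413.F0P3SLayerFoldShapesRel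

open NumberField NumberField.InfinitePlace MeasureTheory
open scoped Matrix MatrixGroups ComplexOrder
open Literature.RepresentationTheory.BorelWallach2000
open Literature.NumberTheory.Automorphic Literature.NumberTheory.Automorphic.UnitaryGroup
open Literature.NumberTheory.Automorphic.UnitaryGroup.CotangentForms
open Literature.RepresentationTheory.KonnoKonno2007 Literature.RepresentationTheory.KonnoKonno2007.RealDualPair
open Literature.RepresentationTheory.KonnoKonno2007.RealDualPair.UForm

section Datum

/-! Throughout: ONE CM datum `(L, ι, H, T, hT, μ)` as in ★ `F0P3SLayerFoldShapes`, and a BOUND packet vocabulary `(Ξ, Mem)`. -/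
variable (L : Type) [Field L] [NumberField L] [IsCMField L] (ι : L →+* ℂ) (H : Matrix (Fin 3) (Fin 3) L) (T : GL (Fin 3) ℂ)
  (hT : (T : Matrix (Fin 3) (Fin 3) ℂ)ᴴ * H.map ι * (T : Matrix (Fin 3) (Fin 3) ℂ) = Literature.Geometry.ComplexHyperbolic.BallModel.J)
  (μ : Measure (adelicGroupData (↥(maximalRealSubfield L)) L (IsCMField.complexConj L) 3 H).automorphicQuotient)
  [(adelicGroupData (↥(maximalRealSubfield L)) L (IsCMField.complexConj L) 3 H).IsAutomorphicMeasure μ]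
  {Ξ : Type*}
  (Mem : DiscreteAutomorphicRep (adelicGroupData (↥(maximalRealSubfield L)) L (IsCMField.complexConj L) 3 H) μ → Ξ → Prop)

/-- **β_opp ⇐ S2♭ + RELATIVE sign clause + S3♭ (pointwise fold; pure logic).**  As `betaOpp_pointwise_of_SLayer`, with the sign
clause in relative form `hSgnRel` (same packet ⇒ same archimedean type): `ξ` for `P` (type `+1`) and `ξ′` for `P′` (type `−1`) from
(hS2), `ξ = ξ′` by (hS3), then (hSgnRel) gives `1 = −1`.  No sign function, no convention. [cite: Rogawski1990, Thm. 13.3.6 (c);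
Thm. 13.3.5; §14.6 Thm. 14.6.4; §12.3 p. 178; Prop. 15.2.1 (b); §15.3 ¶1] -/
theorem betaOpp_pointwise_of_SLayer_rel
    (hS2 : ∀ (P : DiscreteAutomorphicRep (adelicGroupData (↥(maximalRealSubfield L)) L (IsCMField.complexConj L) 3 H) μ)
      (M : Type) [AddCommGroup M] [Module ℂ M] (σK : Representation ℂ (uFormGroup (Fin 2) (Fin 1)).maximalCompact M)
      (σ𝔤 : (uFormGroup (Fin 2) (Fin 1)).lie →ₗ⁅ℝ⁆ Module.End ℂ M) (hM : IsGKModule (uFormGroup (Fin 2) (Fin 1)) σK σ𝔤),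
      IsIrreducibleGK σK σ𝔤 →
      (∃ T₁ : P.archModuleCM ι T hT →ₗ[ℂ] M,
        (∀ (k : (uFormGroup (Fin 2) (Fin 1)).maximalCompact) (w : P.archModuleCM ι T hT),
            T₁ (P.archRepKCM ι T hT k w) = σK k (T₁ w)) ∧
          (∀ (X : (uFormGroup (Fin 2) (Fin 1)).lie) (w : P.archModuleCM ι T hT),
            T₁ (P.archRepLieCM ι T hT X w) = σ𝔤 X (T₁ w)) ∧ T₁ ≠ 0) →
      ∀ δ : ℤ, (δ = 1 ∨ δ = -1) → upqTypeClasses σK σ𝔤 hM.ad_compat 1 δ ≠ ⊥ → ∃ ξ : Ξ, Mem P ξ)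
    (hS3 : ∀ (W : Type) [AddCommGroup W] [Module ℂ W]
      (σ : Representation ℂ (finAdelic (↥(maximalRealSubfield L)) L (IsCMField.complexConj L) 3 H) W),
      σ.IsIrreducible → σ.IsSmooth →
      ∀ (P P' : DiscreteAutomorphicRep (adelicGroupData (↥(maximalRealSubfield L)) L (IsCMField.complexConj L) 3 H) μ) (ξ ξ' : Ξ),
        P.HasFinComponent σ → P'.HasFinComponent σ → Mem P ξ → Mem P' ξ' → ξ = ξ')
    (hSgnRel : ∀ (P P' : DiscreteAutomorphicRep (adelicGroupData (↥(maximalRealSubfield L)) L (IsCMField.complexConj L) 3 H) μ)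
      (ξ : Ξ), Mem P ξ → Mem P' ξ →
      ∀ (M : Type) [AddCommGroup M] [Module ℂ M] (σK : Representation ℂ (uFormGroup (Fin 2) (Fin 1)).maximalCompact M)
        (σ𝔤 : (uFormGroup (Fin 2) (Fin 1)).lie →ₗ⁅ℝ⁆ Module.End ℂ M) (hM : IsGKModule (uFormGroup (Fin 2) (Fin 1)) σK σ𝔤),
        IsIrreducibleGK σK σ𝔤 →
        (∃ T₁ : P.archModuleCM ι T hT →ₗ[ℂ] M,
          (∀ (k : (uFormGroup (Fin 2) (Fin 1)).maximalCompact) (w : P.archModuleCM ι T hT),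
              T₁ (P.archRepKCM ι T hT k w) = σK k (T₁ w)) ∧
            (∀ (X : (uFormGroup (Fin 2) (Fin 1)).lie) (w : P.archModuleCM ι T hT),
              T₁ (P.archRepLieCM ι T hT X w) = σ𝔤 X (T₁ w)) ∧ T₁ ≠ 0) →
      ∀ (M' : Type) [AddCommGroup M'] [Module ℂ M'] (σK' : Representation ℂ (uFormGroup (Fin 2) (Fin 1)).maximalCompact M')
        (σ𝔤' : (uFormGroup (Fin 2) (Fin 1)).lie →ₗ⁅ℝ⁆ Module.End ℂ M') (hM' : IsGKModule (uFormGroup (Fin 2) (Fin 1)) σK' σ𝔤'),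
        IsIrreducibleGK σK' σ𝔤' →
        (∃ T₂ : P'.archModuleCM ι T hT →ₗ[ℂ] M',
          (∀ (k : (uFormGroup (Fin 2) (Fin 1)).maximalCompact) (w : P'.archModuleCM ι T hT),
              T₂ (P'.archRepKCM ι T hT k w) = σK' k (T₂ w)) ∧
            (∀ (X : (uFormGroup (Fin 2) (Fin 1)).lie) (w : P'.archModuleCM ι T hT),
              T₂ (P'.archRepLieCM ι T hT X w) = σ𝔤' X (T₂ w)) ∧ T₂ ≠ 0) →
      ∀ (δ δ' : ℤ), (δ = 1 ∨ δ = -1) → (δ' = 1 ∨ δ' = -1) →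
        upqTypeClasses σK σ𝔤 hM.ad_compat 1 δ ≠ ⊥ → upqTypeClasses σK' σ𝔤' hM'.ad_compat 1 δ' ≠ ⊥ → δ = δ') :
    ∀ (W : Type) [AddCommGroup W] [Module ℂ W]
      (σ : Representation ℂ (finAdelic (↥(maximalRealSubfield L)) L (IsCMField.complexConj L) 3 H) W),
      σ.IsIrreducible → σ.IsSmooth →
    ∀ (P P' : DiscreteAutomorphicRep (adelicGroupData (↥(maximalRealSubfield L)) L (IsCMField.complexConj L) 3 H) μ),
      P.HasFinComponent σ → P'.HasFinComponent σ →
    ∀ (M : Type) [AddCommGroup M] [Module ℂ M] (σK : Representation ℂ (uFormGroup (Fin 2) (Fin 1)).maximalCompact M)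
      (σ𝔤 : (uFormGroup (Fin 2) (Fin 1)).lie →ₗ⁅ℝ⁆ Module.End ℂ M) (hM : IsGKModule (uFormGroup (Fin 2) (Fin 1)) σK σ𝔤),
      IsIrreducibleGK σK σ𝔤 →
      (∃ T₁ : P.archModuleCM ι T hT →ₗ[ℂ] M,
        (∀ (k : (uFormGroup (Fin 2) (Fin 1)).maximalCompact) (w : P.archModuleCM ι T hT),
            T₁ (P.archRepKCM ι T hT k w) = σK k (T₁ w)) ∧
          (∀ (X : (uFormGroup (Fin 2) (Fin 1)).lie) (w : P.archModuleCM ι T hT),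
            T₁ (P.archRepLieCM ι T hT X w) = σ𝔤 X (T₁ w)) ∧ T₁ ≠ 0) →
    ∀ (M' : Type) [AddCommGroup M'] [Module ℂ M'] (σK' : Representation ℂ (uFormGroup (Fin 2) (Fin 1)).maximalCompact M')
      (σ𝔤' : (uFormGroup (Fin 2) (Fin 1)).lie →ₗ⁅ℝ⁆ Module.End ℂ M') (hM' : IsGKModule (uFormGroup (Fin 2) (Fin 1)) σK' σ𝔤'),
      IsIrreducibleGK σK' σ𝔤' →
      (∃ T₂ : P'.archModuleCM ι T hT →ₗ[ℂ] M',
        (∀ (k : (uFormGroup (Fin 2) (Fin 1)).maximalCompact) (w : P'.archModuleCM ι T hT),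
            T₂ (P'.archRepKCM ι T hT k w) = σK' k (T₂ w)) ∧
          (∀ (X : (uFormGroup (Fin 2) (Fin 1)).lie) (w : P'.archModuleCM ι T hT),
            T₂ (P'.archRepLieCM ι T hT X w) = σ𝔤' X (T₂ w)) ∧ T₂ ≠ 0) →
      upqTypeClasses σK σ𝔤 hM.ad_compat 1 1 ≠ ⊥ → upqTypeClasses σK' σ𝔤' hM'.ad_compat 1 (-1) ≠ ⊥ → False := by
  intro W _ _ σ hirr hsm P P' hfin hfin' M _ _ σK σ𝔤 hM hirrM hT₁ M' _ _ σK' σ𝔤' hM' hirrM' hT₂ hne hne'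
  -- S2♭: both `P` and `P′` lie in A-packets
  obtain ⟨ξ, hξ⟩ := hS2 P M σK σ𝔤 hM hirrM hT₁ 1 (Or.inl rfl) hne
  obtain ⟨ξ', hξ'⟩ := hS2 P' M' σK' σ𝔤' hM' hirrM' hT₂ (-1) (Or.inr rfl) hne'
  -- S3♭: the common finite component pins the packet
  have h₃ : ξ = ξ' := hS3 W σ hirr hsm P P' ξ ξ' hfin hfin' hξ hξ'
  subst h₃
  -- relative sign clause: same packet ⇒ same archimedean type, `1 = −1`
  have h := hSgnRel P P' ξ hξ hξ' M σK σ𝔤 hM hirrM hT₁ M' σK' σ𝔤' hM' hirrM' hT₂ 1 (-1) (Or.inl rfl) (Or.inr rfl) hne hne'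
  omega

/-- **β_opp ⇐ S2♭ + TRANSFER + RELATIVE sign clause (pointwise fold; pure logic).**  As `betaOpp_pointwise_of_SLayer_rel`, with S3♭
(uniqueness of `ξ`) replaced by the TRANSFER shape `hTrans` («membership in `Π′(ξ)` passes between discrete `P`, `P′` with a common
irreducible smooth finite component», the in-house target T♭ of F0P3-plan (g3) ruling (Q3)): `ξ` for `P` (type `+1`) from (hS2),
`Mem P′ ξ` by (hTrans), then (hSgnRel) gives `1 = −1` — (hS2) is not even needed for `P′`. [cite: Rogawski1990, Thm. 13.3.6 (c);
Thm. 13.3.5; §14.6 Thm. 14.6.4; §12.3 p. 178; Prop. 15.2.1 (b); §15.3 ¶1] -/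
theorem betaOpp_pointwise_of_SLayer_trans
    (hS2 : ∀ (P : DiscreteAutomorphicRep (adelicGroupData (↥(maximalRealSubfield L)) L (IsCMField.complexConj L) 3 H) μ)
      (M : Type) [AddCommGroup M] [Module ℂ M] (σK : Representation ℂ (uFormGroup (Fin 2) (Fin 1)).maximalCompact M)
      (σ𝔤 : (uFormGroup (Fin 2) (Fin 1)).lie →ₗ⁅ℝ⁆ Module.End ℂ M) (hM : IsGKModule (uFormGroup (Fin 2) (Fin 1)) σK σ𝔤),
      IsIrreducibleGK σK σ𝔤 →
      (∃ T₁ : P.archModuleCM ι T hT →ₗ[ℂ] M,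
        (∀ (k : (uFormGroup (Fin 2) (Fin 1)).maximalCompact) (w : P.archModuleCM ι T hT),
            T₁ (P.archRepKCM ι T hT k w) = σK k (T₁ w)) ∧
          (∀ (X : (uFormGroup (Fin 2) (Fin 1)).lie) (w : P.archModuleCM ι T hT),
            T₁ (P.archRepLieCM ι T hT X w) = σ𝔤 X (T₁ w)) ∧ T₁ ≠ 0) →
      ∀ δ : ℤ, (δ = 1 ∨ δ = -1) → upqTypeClasses σK σ𝔤 hM.ad_compat 1 δ ≠ ⊥ → ∃ ξ : Ξ, Mem P ξ)
    (hTrans : ∀ (W : Type) [AddCommGroup W] [Module ℂ W]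
      (σ : Representation ℂ (finAdelic (↥(maximalRealSubfield L)) L (IsCMField.complexConj L) 3 H) W),
      σ.IsIrreducible → σ.IsSmooth →
      ∀ (P P' : DiscreteAutomorphicRep (adelicGroupData (↥(maximalRealSubfield L)) L (IsCMField.complexConj L) 3 H) μ) (ξ : Ξ),
        P.HasFinComponent σ → P'.HasFinComponent σ → Mem P ξ → Mem P' ξ)
    (hSgnRel : ∀ (P P' : DiscreteAutomorphicRep (adelicGroupData (↥(maximalRealSubfield L)) L (IsCMField.complexConj L) 3 H) μ)
      (ξ : Ξ), Mem P ξ → Mem P' ξ →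
      ∀ (M : Type) [AddCommGroup M] [Module ℂ M] (σK : Representation ℂ (uFormGroup (Fin 2) (Fin 1)).maximalCompact M)
        (σ𝔤 : (uFormGroup (Fin 2) (Fin 1)).lie →ₗ⁅ℝ⁆ Module.End ℂ M) (hM : IsGKModule (uFormGroup (Fin 2) (Fin 1)) σK σ𝔤),
        IsIrreducibleGK σK σ𝔤 →
        (∃ T₁ : P.archModuleCM ι T hT →ₗ[ℂ] M,
          (∀ (k : (uFormGroup (Fin 2) (Fin 1)).maximalCompact) (w : P.archModuleCM ι T hT),
              T₁ (P.archRepKCM ι T hT k w) = σK k (T₁ w)) ∧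
            (∀ (X : (uFormGroup (Fin 2) (Fin 1)).lie) (w : P.archModuleCM ι T hT),
              T₁ (P.archRepLieCM ι T hT X w) = σ𝔤 X (T₁ w)) ∧ T₁ ≠ 0) →
      ∀ (M' : Type) [AddCommGroup M'] [Module ℂ M'] (σK' : Representation ℂ (uFormGroup (Fin 2) (Fin 1)).maximalCompact M')
        (σ𝔤' : (uFormGroup (Fin 2) (Fin 1)).lie →ₗ⁅ℝ⁆ Module.End ℂ M') (hM' : IsGKModule (uFormGroup (Fin 2) (Fin 1)) σK' σ𝔤'),
        IsIrreducibleGK σK' σ𝔤' →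
        (∃ T₂ : P'.archModuleCM ι T hT →ₗ[ℂ] M',
          (∀ (k : (uFormGroup (Fin 2) (Fin 1)).maximalCompact) (w : P'.archModuleCM ι T hT),
              T₂ (P'.archRepKCM ι T hT k w) = σK' k (T₂ w)) ∧
            (∀ (X : (uFormGroup (Fin 2) (Fin 1)).lie) (w : P'.archModuleCM ι T hT),
              T₂ (P'.archRepLieCM ι T hT X w) = σ𝔤' X (T₂ w)) ∧ T₂ ≠ 0) →
      ∀ (δ δ' : ℤ), (δ = 1 ∨ δ = -1) → (δ' = 1 ∨ δ' = -1) →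
        upqTypeClasses σK σ𝔤 hM.ad_compat 1 δ ≠ ⊥ → upqTypeClasses σK' σ𝔤' hM'.ad_compat 1 δ' ≠ ⊥ → δ = δ') :
    ∀ (W : Type) [AddCommGroup W] [Module ℂ W]
      (σ : Representation ℂ (finAdelic (↥(maximalRealSubfield L)) L (IsCMField.complexConj L) 3 H) W),
      σ.IsIrreducible → σ.IsSmooth →
    ∀ (P P' : DiscreteAutomorphicRep (adelicGroupData (↥(maximalRealSubfield L)) L (IsCMField.complexConj L) 3 H) μ),
      P.HasFinComponent σ → P'.HasFinComponent σ →
    ∀ (M : Type) [AddCommGroup M] [Module ℂ M] (σK : Representation ℂ (uFormGroup (Fin 2) (Fin 1)).maximalCompact M)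
      (σ𝔤 : (uFormGroup (Fin 2) (Fin 1)).lie →ₗ⁅ℝ⁆ Module.End ℂ M) (hM : IsGKModule (uFormGroup (Fin 2) (Fin 1)) σK σ𝔤),
      IsIrreducibleGK σK σ𝔤 →
      (∃ T₁ : P.archModuleCM ι T hT →ₗ[ℂ] M,
        (∀ (k : (uFormGroup (Fin 2) (Fin 1)).maximalCompact) (w : P.archModuleCM ι T hT),
            T₁ (P.archRepKCM ι T hT k w) = σK k (T₁ w)) ∧
          (∀ (X : (uFormGroup (Fin 2) (Fin 1)).lie) (w : P.archModuleCM ι T hT),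
            T₁ (P.archRepLieCM ι T hT X w) = σ𝔤 X (T₁ w)) ∧ T₁ ≠ 0) →
    ∀ (M' : Type) [AddCommGroup M'] [Module ℂ M'] (σK' : Representation ℂ (uFormGroup (Fin 2) (Fin 1)).maximalCompact M')
      (σ𝔤' : (uFormGroup (Fin 2) (Fin 1)).lie →ₗ⁅ℝ⁆ Module.End ℂ M') (hM' : IsGKModule (uFormGroup (Fin 2) (Fin 1)) σK' σ𝔤'),
      IsIrreducibleGK σK' σ𝔤' →
      (∃ T₂ : P'.archModuleCM ι T hT →ₗ[ℂ] M',
        (∀ (k : (uFormGroup (Fin 2) (Fin 1)).maximalCompact) (w : P'.archModuleCM ι T hT),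
            T₂ (P'.archRepKCM ι T hT k w) = σK' k (T₂ w)) ∧
          (∀ (X : (uFormGroup (Fin 2) (Fin 1)).lie) (w : P'.archModuleCM ι T hT),
            T₂ (P'.archRepLieCM ι T hT X w) = σ𝔤' X (T₂ w)) ∧ T₂ ≠ 0) →
      upqTypeClasses σK σ𝔤 hM.ad_compat 1 1 ≠ ⊥ → upqTypeClasses σK' σ𝔤' hM'.ad_compat 1 (-1) ≠ ⊥ → False := by
  intro W _ _ σ hirr hsm P P' hfin hfin' M _ _ σK σ𝔤 hM hirrM hT₁ M' _ _ σK' σ𝔤' hM' hirrM' hT₂ hne hne'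
  -- S2♭: `P` lies in an A-packet `ξ`
  obtain ⟨ξ, hξ⟩ := hS2 P M σK σ𝔤 hM hirrM hT₁ 1 (Or.inl rfl) hne
  -- transfer: so does `P′`, over the common finite component `σ`
  have hξ' : Mem P' ξ := hTrans W σ hirr hsm P P' ξ hfin hfin' hξ
  -- relative sign clause: same packet ⇒ same archimedean type, `1 = −1`
  have h := hSgnRel P P' ξ hξ hξ' M σK σ𝔤 hM hirrM hT₁ M' σK' σ𝔤' hM' hirrM' hT₂ 1 (-1) (Or.inl rfl) (Or.inr rfl) hne hne'
  omega

end Datum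

end Summit.HodgeConjecture.HodgeConjecture.Cruxes.H413.F0P3SLayerFoldShapesRel

end
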